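import Summits.AtomisticToContinuum.BoseEinsteinCondensation.Theses.BECCutLineWeakDisorder
import Literature.MathematicalPhysics.QuantumManyBody.SwapPurity
import Literature.MathematicalPhysics.QuantumManyBody.DyadicCoherentFractionLimit
import Mathlib
import HarnessLib

/-!
# Route `BECCutLineWeakDisorder` — support item `FlatModeFromLandscape` (stmt-AtomisticToContinuum-9088)

The route decl `FlatModeFromLandscape`, proved as stated: for `L > 0` and a NONNEGATIVE admissible
trial state `Ψ ∈ TrialState (n+1) L` (hypothesis `Ψ X = ‖Ψ X‖`),

  `(n + 1) ≤ occ(φ₀, Ψ) · ∫ L³ m(Y)² / s(Y)² dY`,  `φ₀ = L^{-3/2} 1_{Λ_L}`,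

where `m(Y) = ∫ |Ψ(x, Y)|² dx`, `s(Y) = ∫ |Ψ(x, Y)| dx` (`Y ∈ (ℝ³)ⁿ` the other particles) and
`occ(φ₀, Ψ) = (n+1) ∫ |∫ conj φ₀(x) Ψ(x, Y) dx|² dY` is `BoseGas.occupation`.

Proof (the planner's two lines, DPRE reading `n₀/N ≥ 1/E[W²]`): since `Ψ ≥ 0` vanishes off the box,
`∫ conj φ₀(x) Ψ(x, Y) dx = L^{-3/2} s(Y)`, so `occ = (n+1) L⁻³ ∫ s²`; by Tonelli `1 = ∫ |Ψ|² = ∫ m(Y) dY`,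
and pointwise `m = (L^{3/2} m/s) · (L^{-3/2} s)` (where `s(Y) = 0` also `m(Y) = 0`; `s(Y) < ∞` because the
slice `x ↦ Ψ(x, Y)` is continuous with compact support), so Cauchy–Schwarz in `dY` gives
`1 ≤ (∫ L³ m²/s²) · (∫ L⁻³ s²)`, whence the claim after multiplying by `n + 1`.

Ingredients: `lintegral_lintegral_sq_nnnorm_vecCons`, `lintegral_mul_sq_le`, `measurable_vecCons`
(`SwapPurity.lean`); `TrialState.hasCompactSupport`, `dist_vecCons_vecCons`
(`DyadicCoherentFractionLimit.lean`); Mathlib's `integral_complex_ofReal`, `integral_const_mul`,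
`ofReal_integral_norm_eq_lintegral_enorm`, `Isometry.isClosedEmbedding`, `lintegral_eq_zero_iff`.
No named facts are used (unconditional).
-/

noncomputable section

open MeasureTheory Set Filter
open scoped ENNReal NNReal ComplexConjugate

namespace Summit.AtomisticToContinuum.BoseEinsteinCondensation.Theorems

open Literature.MathematicalPhysics.QuantumManyBody.BoseGas
open Summit.AtomisticToContinuum.BoseEinsteinCondensation.Theses.BECCutLineWeakDisorder

namespace FlatModeFromLandscape

variable {n : ℕ} {L : ℝ}

/-- The slice `x ↦ Ψ(x, Y)` of an admissible trial state is continuous. [folklore] -/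
theorem continuous_slice (Ψ : TrialState (n + 1) L) (Y : Config n) :
    Continuous fun x : Space => Ψ.ψ (Matrix.vecCons x Y) :=
  Ψ.contDiff.continuous.comp (continuous_id.matrixVecCons continuous_const)

/-- The slice `x ↦ Ψ(x, Y)` vanishes off the box `Λ_L` (Dirichlet condition in the first particle).
[folklore] -/
theorem slice_eq_zero (Ψ : TrialState (n + 1) L) (Y : Config n) {x : Space} (hx : x ∉ box L) :
    Ψ.ψ (Matrix.vecCons x Y) = 0 :=
  Ψ.eq_zero _ fun h => hx (by simpa using h 0)

/-- The slice `x ↦ Ψ(x, Y)` is integrable: it is continuous with compact support, `Ψ` having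
compact support (`TrialState.hasCompactSupport`) and the insertion `x ↦ (x, Y)` being an isometry
(`dist_vecCons_vecCons`), hence a closed embedding. [folklore] -/
theorem integrable_slice (Ψ : TrialState (n + 1) L) (Y : Config n) :
    Integrable (fun x : Space => Ψ.ψ (Matrix.vecCons x Y)) :=
  (continuous_slice Ψ Y).integrable_of_hasCompactSupport
    (Ψ.hasCompactSupport.comp_isClosedEmbedding
      (Isometry.isClosedEmbedding fun x y => by
        rw [edist_dist, edist_dist, dist_vecCons_vecCons]))

/-- Against the flat mode the integrand is `L^{-3/2} Ψ(x, Y)` everywhere (both sides vanish off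
the box). [folklore] -/
theorem conj_flatMode_mul_slice (Ψ : TrialState (n + 1) L) (Y : Config n) (x : Space) :
    conj ((box L).indicator (fun _ => ((Real.sqrt (L ^ 3))⁻¹ : ℂ)) x) * Ψ.ψ (Matrix.vecCons x Y) =
      ((Real.sqrt (L ^ 3))⁻¹ : ℂ) * Ψ.ψ (Matrix.vecCons x Y) := by
  by_cases hx : x ∈ box L
  · rw [Set.indicator_of_mem hx, map_inv₀, Complex.conj_ofReal]
  · rw [Set.indicator_of_notMem hx, map_zero, slice_eq_zero Ψ Y hx, mul_zero, mul_zero]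

/-- For a nonnegative state, `∫ conj φ₀(x) Ψ(x, Y) dx = L^{-3/2} · ∫ ‖Ψ(x, Y)‖ dx` (a real,
nonnegative number cast to `ℂ`). [folklore] -/
theorem integral_conj_flatMode_mul_slice (Ψ : TrialState (n + 1) L)
    (hΨ : ∀ X, Ψ.ψ X = (‖Ψ.ψ X‖ : ℂ)) (Y : Config n) :
    ∫ x, conj ((box L).indicator (fun _ => ((Real.sqrt (L ^ 3))⁻¹ : ℂ)) x) * Ψ.ψ (Matrix.vecCons x Y) =
      ((Real.sqrt (L ^ 3))⁻¹ : ℂ) * ((∫ x, ‖Ψ.ψ (Matrix.vecCons x Y)‖ : ℝ) : ℂ) := by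
  simp_rw [conj_flatMode_mul_slice Ψ Y]
  rw [integral_const_mul, ← integral_complex_ofReal]
  congr 1
  exact integral_congr_ae (Eventually.of_forall fun x => hΨ _)

/-- The `[0, ∞]`-valued modulus of the flat-mode pairing: `‖∫ conj φ₀ Ψ(·, Y)‖ = L^{-3/2} s(Y)` with
`s(Y) = ∫ ‖Ψ(x, Y)‖ dx` as a lower Lebesgue integral. [folklore] -/
theorem enorm_integral_conj_flatMode_mul_slice (hL : 0 < L) (Ψ : TrialState (n + 1) L)
    (hΨ : ∀ X, Ψ.ψ X = (‖Ψ.ψ X‖ : ℂ)) (Y : Config n) :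
    (‖∫ x, conj ((box L).indicator (fun _ => ((Real.sqrt (L ^ 3))⁻¹ : ℂ)) x) *
        Ψ.ψ (Matrix.vecCons x Y)‖₊ : ℝ≥0∞) =
      (ENNReal.ofReal (Real.sqrt (L ^ 3)))⁻¹ * ∫⁻ x, (‖Ψ.ψ (Matrix.vecCons x Y)‖₊ : ℝ≥0∞) := by
  have hs : 0 < Real.sqrt (L ^ 3) := Real.sqrt_pos.2 (by positivity)
  rw [integral_conj_flatMode_mul_slice Ψ hΨ Y, nnnorm_mul, ENNReal.coe_mul]
  congr 1
  · rw [← Complex.ofReal_inv, Complex.nnnorm_real, ← enorm_eq_nnnorm, ← ofReal_norm,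
      Real.norm_of_nonneg (inv_nonneg.2 hs.le), ENNReal.ofReal_inv_of_pos hs]
  · rw [Complex.nnnorm_real, ← enorm_eq_nnnorm, ← ofReal_norm,
      Real.norm_of_nonneg (integral_nonneg fun _ => norm_nonneg _),
      ofReal_integral_norm_eq_lintegral_enorm (integrable_slice Ψ Y)]
    rfl

/-- **Cauchy–Schwarz at the joining point** (abstract form): if `∫ m = 1`, `s < ∞`, `s = 0 ⇒ m = 0`
and `G = c⁻¹ s` for a constant `0 < c < ∞` with `c² = C`, then
`N ≤ (N ∫ G²) · ∫ C m²/s²`. [folklore] -/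
theorem le_mul_lintegral_of_lintegral_eq_one {α : Type*} [MeasurableSpace α] {μ : Measure α}
    (c C N : ℝ≥0∞) (hc0 : c ≠ 0) (hctop : c ≠ ⊤) (hcC : c ^ 2 = C) {m s G : α → ℝ≥0∞}
    (hm : Measurable m) (hs : Measurable s) (hsfin : ∀ Y, s Y ≠ ⊤)
    (hsm : ∀ Y, s Y = 0 → m Y = 0) (hG : ∀ Y, G Y = c⁻¹ * s Y) (hnorm : ∫⁻ Y, m Y ∂μ = 1) :
    N ≤ (N * ∫⁻ Y, G Y ^ 2 ∂μ) * ∫⁻ Y, C * m Y ^ 2 / s Y ^ 2 ∂μ := by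
  -- the two Cauchy–Schwarz factors
  set f : α → ℝ≥0∞ := fun Y => c * m Y / s Y with hf
  have hfm : Measurable f := (hm.const_mul c).div hs
  have hGm : Measurable G := by
    have : G = fun Y => c⁻¹ * s Y := funext hG
    rw [this]
    exact hs.const_mul _
  -- pointwise `m ≤ f · G`
  have hfg : ∀ Y, m Y ≤ f Y * G Y := by
    intro Y
    by_cases h0 : s Y = 0
    · rw [hsm Y h0]
      exact zero_le
    · refine le_of_eq ?_
      rw [hG Y, hf]
      calc m Y = m Y * (c * c⁻¹) * ((s Y)⁻¹ * s Y) := by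
            rw [ENNReal.mul_inv_cancel hc0 hctop, ENNReal.inv_mul_cancel h0 (hsfin Y), mul_one,
              mul_one]
        _ = c * m Y / s Y * (c⁻¹ * s Y) := by rw [div_eq_mul_inv]; ring
  -- `1 = ∫ m ≤ ∫ f G ≤ (∫ f²)^{1/2} (∫ G²)^{1/2}`
  have h1 : 1 ≤ ∫⁻ Y, f Y * G Y ∂μ := hnorm ▸ lintegral_mono hfg
  have h2 : (1 : ℝ≥0∞) ≤ (∫⁻ Y, f Y ^ 2 ∂μ) * ∫⁻ Y, G Y ^ 2 ∂μ :=
    calc (1 : ℝ≥0∞) = 1 ^ 2 := (one_pow 2).symm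
      _ ≤ (∫⁻ Y, f Y * G Y ∂μ) ^ 2 := by gcongr
      _ ≤ (∫⁻ Y, f Y ^ 2 ∂μ) * ∫⁻ Y, G Y ^ 2 ∂μ :=
          lintegral_mul_sq_le μ hfm.aemeasurable hGm.aemeasurable
  -- `f² = C m²/s²`
  have hf2 : ∀ Y, f Y ^ 2 = C * m Y ^ 2 / s Y ^ 2 := by
    intro Y
    rw [hf]
    dsimp only
    rw [div_eq_mul_inv, mul_pow, mul_pow, ← ENNReal.inv_pow, hcC, ← div_eq_mul_inv]
  simp_rw [hf2] at h2
  calc N = N * 1 := (mul_one N).symm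
    _ ≤ N * ((∫⁻ Y, C * m Y ^ 2 / s Y ^ 2 ∂μ) * ∫⁻ Y, G Y ^ 2 ∂μ) := by gcongr
    _ = (N * ∫⁻ Y, G Y ^ 2 ∂μ) * ∫⁻ Y, C * m Y ^ 2 / s Y ^ 2 ∂μ := by ring

end FlatModeFromLandscape

open FlatModeFromLandscape in
/-- **`FlatModeFromLandscape` (stmt-AtomisticToContinuum-9088), as stated in the route file.**
For `L > 0` and a nonnegative `Ψ ∈ TrialState (n+1) L`,
`(n+1) ≤ ⟨φ₀, γ_Ψ φ₀⟩ · ∫ L³ m(Y)²/s(Y)² dY` with `φ₀ = L^{-3/2} 1_{Λ_L}` (Tonelli in `x :: Y`, `∫ m = 1`,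
Cauchy–Schwarz in `dY`). [folklore] -/
theorem flatModeFromLandscape_proof : FlatModeFromLandscape := by
  intro n L hL Ψ hΨ
  have hL3 : 0 < L ^ 3 := by positivity
  have hsq : 0 < Real.sqrt (L ^ 3) := Real.sqrt_pos.2 hL3
  have hΨm : Measurable Ψ.ψ := Ψ.contDiff.continuous.measurable
  -- the slice masses `m(Y) = ∫ |Ψ(x,Y)|² dx`, `s(Y) = ∫ |Ψ(x,Y)| dx` are measurable in `Y`
  have hslice : ∀ Y : Config n, Measurable fun x : Space =>
      (‖Ψ.ψ (Matrix.vecCons x Y)‖₊ : ℝ≥0∞) := fun Y =>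
    (measurable_comp_vecCons_left hΨm Y).nnnorm.coe_nnreal_ennreal
  have hm : Measurable fun Y : Config n => ∫⁻ x, (‖Ψ.ψ (Matrix.vecCons x Y)‖₊ : ℝ≥0∞) ^ 2 :=
    measurable_lintegral_sq_nnnorm_vecCons hΨm
  have hs : Measurable fun Y : Config n => ∫⁻ x, (‖Ψ.ψ (Matrix.vecCons x Y)‖₊ : ℝ≥0∞) :=
    ((hΨm.comp measurable_vecCons).nnnorm.coe_nnreal_ennreal).lintegral_prod_left'
  have hsfin : ∀ Y : Config n, ∫⁻ x, (‖Ψ.ψ (Matrix.vecCons x Y)‖₊ : ℝ≥0∞) ≠ ⊤ := fun Y =>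
    (hasFiniteIntegral_iff_enorm.mp (integrable_slice Ψ Y).2).ne
  have hsm : ∀ Y : Config n, ∫⁻ x, (‖Ψ.ψ (Matrix.vecCons x Y)‖₊ : ℝ≥0∞) = 0 →
      ∫⁻ x, (‖Ψ.ψ (Matrix.vecCons x Y)‖₊ : ℝ≥0∞) ^ 2 = 0 := by
    intro Y h0
    have h1 := (lintegral_eq_zero_iff (hslice Y)).1 h0
    refine (lintegral_eq_zero_iff ((hslice Y).pow_const 2)).2 ?_
    filter_upwards [h1] with x hx
    simp only [Pi.zero_apply] at hx ⊢
    simp [hx]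
  have hnorm : ∫⁻ Y : Config n, ∫⁻ x, (‖Ψ.ψ (Matrix.vecCons x Y)‖₊ : ℝ≥0∞) ^ 2 = 1 := by
    rw [lintegral_lintegral_sq_nnnorm_vecCons hΨm]
    exact Ψ.norm_eq
  have hc0 : ENNReal.ofReal (Real.sqrt (L ^ 3)) ≠ 0 := by
    rwa [Ne, ENNReal.ofReal_eq_zero, not_le]
  have hcC : ENNReal.ofReal (Real.sqrt (L ^ 3)) ^ 2 = ENNReal.ofReal (L ^ 3) := by
    rw [← ENNReal.ofReal_pow hsq.le, Real.sq_sqrt hL3.le]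
  rw [Nat.cast_succ]
  exact le_mul_lintegral_of_lintegral_eq_one (μ := volume) (ENNReal.ofReal (Real.sqrt (L ^ 3)))
    (ENNReal.ofReal (L ^ 3)) ((n : ℝ≥0∞) + 1) hc0 ENNReal.ofReal_ne_top hcC hm hs hsfin hsm
    (enorm_integral_conj_flatMode_mul_slice hL Ψ hΨ) hnorm

end Summit.AtomisticToContinuum.BoseEinsteinCondensation.Theorems

end
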